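import Literature.AlgebraicGeometry.HodgeTheory.HodgeFramesOfOrthogonalComplement
import HarnessLib

/-!
# Holomorphic frames of ALL Hodge bundles of a weight-`2` variation from a holomorphic frame of `F²`

Family `hodge`, layer `Literature/AlgebraicGeometry/HodgeTheory`; proof file (theorems only, no
definition, no named fact). Written by the prover seat `hodge-nonav-prover-Ax` (g11, cell `hodge-nonav`)
for the programme «GRIFFITHS-SURFACES» (route `HodgeConjecture/CyclicUnitaryPowers`).

The subbundle-frame hypothesis of `exists_holomorphicFrame_of_subbundleFrames`
(`HodgeFramesOfHolomorphicSubbundles`; = the shape of the named fact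
`Griffiths1968_holomorphicHodgeSubbundles`, Voisin I Thm. 10.3) asks, for EVERY `p`, for a holomorphic
frame of `F^p` of the transported Hodge structures along a flat trivialisation. For Hodge structures of
WEIGHT `2` of level `≤ 2` (`F⁰ = ⊤`, `F³ = ⊥`: the `H²` of a smooth projective variety) carrying a
pairing `B`, read on the base fibre, for which the transported `F¹` is the `B`-orthogonal of the
transported `F²` (first Hodge–Riemann relation, `Polarization.mem_F_iff_forall_form_eq_zero` of
`HodgeStructurePolarizationFiltrationOrthogonal`, for a FLAT polarization), such frames for all `p`
follow from a holomorphic frame of `F²` ALONE: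

* `exists_subbundleFrames_of_weightTwo` — `p ≤ 0`: a constant basis; `p = 2`: the given frame;
  `p = 1`: the analytic frame of the `B`-orthogonal of the `F²`-frame
  (`exists_analyticFrame_orthogonal`, on the path component of the reference point in the good set);
  `p ≥ 3`: the empty frame. Output in the exact shape consumed by
  `exists_holomorphicFrame_of_subbundleFrames` (per `p`: `∃ r w, …`).

So, for a family of smooth projective SURFACES (`k = 2`), Griffiths' holomorphy of the Hodge bundles —
hence the analytic dichotomy of Hodge loci and the meagreness of the non-Hodge-generic points
(`HodgeGenericPointsComeagre`) — reduces to the holomorphic variation of the line(s) of holomorphic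
`2`-forms `F²H² = H^{2,0}` (for hypersurfaces: Griffiths residues) and the flatness of a polarization.

## References

* [VoisinHodgeI2002] C. Voisin, Hodge Theory and Complex Algebraic Geometry I, CUP (2002), §7.1.2
  (first Hodge–Riemann relation), §10.2.1 Thm. 10.3.
* [Griffiths1968PeriodsII] P. Griffiths, Periods of integrals on algebraic manifolds II, Amer. J. Math.
  90 (1968), Thm. 1.1.
-/

noncomputable section

open CategoryTheory AlgebraicGeometry
open _root_.Topology _root_.Filter
open scoped TensorProduct
open Literature.AlgebraicTopology.SingularHomology
open Literature.AlgebraicGeometry.Motives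

namespace Literature.AlgebraicGeometry.HodgeTheory

section HodgeTheory

section WeightTwo

variable {𝒳 S : SchemeOver ℂ} (f : 𝒳 ⟶ S) (k : ℕ) {U : Set (ComplexPoints S)}
  (hU : IsCohomologicallyLocallyTrivialOn f U)

/-- **Frames of all `F^p` of a weight-`2`, level-`≤ 2` variation from a holomorphic frame of `F²` and a
pairing for which `F¹ = (F²)^⊥`.** Setting of `exists_holomorphicFrame_of_subbundleFrames`: `U`
cohomologically trivialising, base point `s`, weight-`2` Hodge structures `H t` on the rational fibres
`Hᵏ(X_t; ℚ)` with `F⁰ = ⊤` and `F³ = ⊥`, a path-connected open `W₀` inside a chart `ψ`, a reference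
admissible state `(t₁, T₁)`; a right-separating bilinear form `B` on `ℂ ⊗ Hᵏ(X_s; ℚ)` such that, along
every continuation `T` of `T₁` inside `W₀`, `x ∈ F¹(T^*H_t) ↔ B(x, F²(T^*H_t)) = 0`; and a frame
`w₂ i t` (`i < r₂`) of `F²(T^*H_t)` along those continuations with holomorphic coordinates on `ψ(W₀)`.
Conclusion: on a path-connected open `W ∋ t₁` inside `W₀`, for every `p` a frame of `F^p(T^*H_t)` along
the continuations inside `W`, with holomorphic coordinates on `ψ(W)`.
[cite: VoisinHodgeI2002, §7.1.2 and §10.2.1 Thm. 10.3] -/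
theorem exists_subbundleFrames_of_weightTwo [LocallyPathConnectedSpace U] (s : U)
    [Module.Finite ℚ (singularCohomology ℚ ℚ (ComplexPoints (fiberOver f s.1)) k)]
    (H : ∀ t : U, HodgeStructure (singularCohomology ℚ ℚ (ComplexPoints (fiberOver f t.1)) k) 2)
    (hF0 : ∀ t : U, (H t).F 0 = ⊤) (hF3 : ∀ t : U, (H t).F 3 = ⊥)
    {W₀ : Set U} (hW₀o : IsOpen W₀)
    {d : ℕ} (ψ : OpenPartialHomeomorph U (Fin d → ℂ)) (hW₀ψ : W₀ ⊆ ψ.source)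
    {t₁ : U} (ht₁ : t₁ ∈ W₀)
    {T₁ : singularCohomology ℚ ℚ (ComplexPoints (fiberOver f s.1)) k ≃ₗ[ℚ]
      singularCohomology ℚ ℚ (ComplexPoints (fiberOver f t₁.1)) k}
    (B : LinearMap.BilinForm ℂ (ℂ ⊗[ℚ] singularCohomology ℚ ℚ (ComplexPoints (fiberOver f s.1)) k))
    (hB : B.SeparatingRight)
    (hB1 : ∀ t ∈ W₀, ∀ (ε : Path t₁ t), (∀ r', ε r' ∈ W₀) →
      ∀ (T : singularCohomology ℚ ℚ (ComplexPoints (fiberOver f s.1)) k ≃ₗ[ℚ]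
        singularCohomology ℚ ℚ (ComplexPoints (fiberOver f t.1)) k),
      (∀ v, ofRatClass _ k (T v) = transportFun f k hU ⟦ε⟧ (ofRatClass _ k (T₁ v))) →
      ∀ x, x ∈ ((H t).comapEquiv T).F 1 ↔ ∀ y ∈ ((H t).comapEquiv T).F 2, B x y = 0)
    {r₂ : ℕ} (w₂ : Fin r₂ → U → ℂ ⊗[ℚ] singularCohomology ℚ ℚ (ComplexPoints (fiberOver f s.1)) k)
    (hw₂ : ∀ t ∈ W₀, ∀ (ε : Path t₁ t), (∀ r', ε r' ∈ W₀) →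
      ∀ (T : singularCohomology ℚ ℚ (ComplexPoints (fiberOver f s.1)) k ≃ₗ[ℚ]
        singularCohomology ℚ ℚ (ComplexPoints (fiberOver f t.1)) k),
      (∀ v, ofRatClass _ k (T v) = transportFun f k hU ⟦ε⟧ (ofRatClass _ k (T₁ v))) →
      LinearIndependent ℂ (fun i ↦ w₂ i t) ∧
        ((H t).comapEquiv T).F 2 = Submodule.span ℂ (Set.range fun i ↦ w₂ i t))
    (hw₂hol : ∀ (i : Fin r₂)
      (φ : Module.Dual ℂ (ℂ ⊗[ℚ] singularCohomology ℚ ℚ (ComplexPoints (fiberOver f s.1)) k)),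
      AnalyticOnNhd ℂ (fun z ↦ φ (w₂ i (ψ.symm z))) (ψ '' W₀)) :
    ∃ W : Set U, IsOpen W ∧ t₁ ∈ W ∧ W ⊆ W₀ ∧ IsPathConnected W ∧
      ∀ p : ℤ, ∃ (r : ℕ)
        (w : Fin r → U → ℂ ⊗[ℚ] singularCohomology ℚ ℚ (ComplexPoints (fiberOver f s.1)) k),
        (∀ t ∈ W, ∀ (ε : Path t₁ t), (∀ r', ε r' ∈ W) →
          ∀ (T : singularCohomology ℚ ℚ (ComplexPoints (fiberOver f s.1)) k ≃ₗ[ℚ]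
            singularCohomology ℚ ℚ (ComplexPoints (fiberOver f t.1)) k),
          (∀ v, ofRatClass _ k (T v) = transportFun f k hU ⟦ε⟧ (ofRatClass _ k (T₁ v))) →
          LinearIndependent ℂ (fun i ↦ w i t) ∧
            ((H t).comapEquiv T).F p = Submodule.span ℂ (Set.range fun i ↦ w i t)) ∧
        (∀ (i : Fin r)
          (φ : Module.Dual ℂ (ℂ ⊗[ℚ] singularCohomology ℚ ℚ (ComplexPoints (fiberOver f s.1)) k)),
          AnalyticOnNhd ℂ (fun z ↦ φ (w i (ψ.symm z))) (ψ '' W)) := by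
  classical
  -- the reference state is a continuation of itself along the constant path
  have hT₁refl : ∀ v, ofRatClass _ k (T₁ v) =
      transportFun f k hU ⟦Path.refl t₁⟧ (ofRatClass _ k (T₁ v)) := fun v ↦ by
    rw [show (⟦Path.refl t₁⟧ : Path.Homotopic.Quotient t₁ t₁) = Path.Homotopic.Quotient.refl t₁ from rfl,
      transportFun_refl]
  -- (1) the `B`-orthogonal frame of the `F²`-frame, in the chart
  have hDo : IsOpen (ψ '' W₀) := ψ.isOpen_image_of_subset_source hW₀o hW₀ψ
  have hli₁ : LinearIndependent ℂ (fun i ↦ w₂ i (ψ.symm (ψ t₁))) := by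
    rw [ψ.left_inv (hW₀ψ ht₁)]
    exact (hw₂ t₁ ht₁ (Path.refl t₁) (fun _ ↦ ht₁) T₁ hT₁refl).1
  obtain ⟨D', hD'o, hz₁, hD'D, m, e, heli, hespan, hehol⟩ := exists_analyticFrame_orthogonal B hB
    hDo (Set.mem_image_of_mem ψ ht₁) (fun i z ↦ w₂ i (ψ.symm z)) hli₁ hw₂hol
  -- (2) the neighbourhood `W`: the path component of `t₁` in `{t ∈ W₀ | ψ t ∈ D'}`
  have hGo : IsOpen (W₀ ∩ ψ ⁻¹' D') := by
    have h := ψ.continuousOn.isOpen_inter_preimage ψ.open_source hD'o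
    have hEq : W₀ ∩ ψ ⁻¹' D' = W₀ ∩ (ψ.source ∩ ψ ⁻¹' D') := by
      ext t
      simp only [Set.mem_inter_iff, Set.mem_preimage]
      exact ⟨fun ht ↦ ⟨ht.1, hW₀ψ ht.1, ht.2⟩, fun ht ↦ ⟨ht.1, ht.2.2⟩⟩
    rw [hEq]
    exact hW₀o.inter h
  have ht₁G : t₁ ∈ W₀ ∩ ψ ⁻¹' D' := ⟨ht₁, hz₁⟩
  refine ⟨pathComponentIn (W₀ ∩ ψ ⁻¹' D') t₁, hGo.pathComponentIn t₁, mem_pathComponentIn_self ht₁G,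
    pathComponentIn_subset.trans Set.inter_subset_left, isPathConnected_pathComponentIn ht₁G, ?_⟩
  set W := pathComponentIn (W₀ ∩ ψ ⁻¹' D') t₁ with hWdef
  have hWW₀ : W ⊆ W₀ := pathComponentIn_subset.trans Set.inter_subset_left
  have hWD' : ∀ t ∈ W, ψ t ∈ D' := fun t ht ↦ (pathComponentIn_subset ht).2
  have hWimD' : ψ '' W ⊆ D' := by rintro _ ⟨t, ht, rfl⟩; exact hWD' t ht
  have hWim : ψ '' W ⊆ ψ '' W₀ := Set.image_mono hWW₀
  have hWio : IsOpen (ψ '' W) := ψ.isOpen_image_of_subset_source (hGo.pathComponentIn t₁) (hWW₀.trans hW₀ψ)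
  -- the transported filtration steps `F^p`, `p ≤ 0` and `p ≥ 3`
  have hFtop : ∀ (t : U) (T : singularCohomology ℚ ℚ (ComplexPoints (fiberOver f s.1)) k ≃ₗ[ℚ]
      singularCohomology ℚ ℚ (ComplexPoints (fiberOver f t.1)) k) (p : ℤ), p ≤ 0 →
      ((H t).comapEquiv T).F p = ⊤ := by
    intro t T p hp
    rw [HodgeStructure.comapEquiv_F, eq_top_iff]
    intro x _
    rw [Submodule.mem_comap]
    exact (H t).antitone_F hp (by rw [hF0 t]; exact Submodule.mem_top)
  have hFbot : ∀ (t : U) (T : singularCohomology ℚ ℚ (ComplexPoints (fiberOver f s.1)) k ≃ₗ[ℚ]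
      singularCohomology ℚ ℚ (ComplexPoints (fiberOver f t.1)) k) (p : ℤ), 3 ≤ p →
      ((H t).comapEquiv T).F p = ⊥ := by
    intro t T p hp
    rw [HodgeStructure.comapEquiv_F, eq_bot_iff]
    intro x hx
    rw [Submodule.mem_comap] at hx
    have h0 : (T.toLinearMap.baseChange ℂ) x = 0 := by
      have hle : (H t).F p ≤ (H t).F 3 := (H t).antitone_F hp
      have := hle hx
      rwa [hF3 t, Submodule.mem_bot] at this
    rw [Submodule.mem_bot]
    exact HodgeStructure.baseChange_injective_of_equiv T (by rw [h0, map_zero])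
  -- a basis of the complexified base fibre
  set N := Module.finrank ℂ (ℂ ⊗[ℚ] singularCohomology ℚ ℚ (ComplexPoints (fiberOver f s.1)) k) with hN
  set bM : Module.Basis (Fin N) ℂ (ℂ ⊗[ℚ] singularCohomology ℚ ℚ (ComplexPoints (fiberOver f s.1)) k) :=
    Module.finBasis ℂ _ with hbM
  intro p
  by_cases hp0 : p ≤ 0
  · -- `p ≤ 0`: constant basis
    refine ⟨N, fun i _ ↦ bM i, fun t ht ε hε T hT ↦ ⟨bM.linearIndependent, ?_⟩,
      fun i φ ↦ analyticOnNhd_const⟩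
    rw [hFtop t T p hp0]
    exact (bM.span_eq.symm.trans (by rfl))
  by_cases hp1 : p = 1
  · -- `p = 1`: the orthogonal frame
    subst hp1
    refine ⟨m, fun i t ↦ e i (ψ t), fun t ht ε hε T hT ↦ ⟨heli (ψ t) (hWD' t ht), ?_⟩, fun i φ ↦ ?_⟩
    · have h2 := hw₂ t (hWW₀ ht) ε (fun r' ↦ hWW₀ (hε r')) T hT
      ext x
      rw [hB1 t (hWW₀ ht) ε (fun r' ↦ hWW₀ (hε r')) T hT x, hespan (ψ t) (hWD' t ht) x, h2.2]
      simp only [ψ.left_inv (hW₀ψ (hWW₀ ht))]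
      constructor
      · intro h i
        exact h _ (Submodule.subset_span ⟨i, rfl⟩)
      · intro h y hy
        induction hy using Submodule.span_induction with
        | mem y hy =>
          obtain ⟨i, rfl⟩ := hy
          exact h i
        | zero => rw [map_zero]
        | add y y' _ _ hy hy' => rw [map_add, hy, hy', add_zero]
        | smul a y _ hy => rw [map_smul, hy, smul_eq_mul, mul_zero]
    · refine ((hehol i φ).mono hWimD').congr hWio ?_
      rintro _ ⟨t, ht, rfl⟩
      change φ (e i (ψ t)) = φ (e i (ψ (ψ.symm (ψ t))))
      rw [ψ.left_inv (hW₀ψ (hWW₀ ht))]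
  by_cases hp2 : p = 2
  · -- `p = 2`: the given frame
    subst hp2
    exact ⟨r₂, w₂, fun t ht ε hε T hT ↦ hw₂ t (hWW₀ ht) ε (fun r' ↦ hWW₀ (hε r')) T hT,
      fun i φ ↦ (hw₂hol i φ).mono hWim⟩
  · -- `p ≥ 3`: the empty frame
    have hp3 : 3 ≤ p := by omega
    refine ⟨0, fun i ↦ Fin.elim0 i, fun t ht ε hε T hT ↦ ⟨linearIndependent_empty_type, ?_⟩,
      fun i ↦ Fin.elim0 i⟩
    rw [hFbot t T p hp3, eq_comm, Submodule.span_eq_bot]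
    rintro _ ⟨i, rfl⟩
    exact Fin.elim0 i

end WeightTwo

end HodgeTheory

end Literature.AlgebraicGeometry.HodgeTheory

end
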